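import Summits.Ventures.YMGap.RobustBall.CentreProjectionWindow
import Summits.Ventures.YMGap.RobustBall.CentreTubeAreaLaw
import HarnessLib

/-!
# RobustBall/CentreTubeWindow — the WINDOWED CENTRE-TUBE AREA LAW: the window-free area law of the centre-blind class
# survives every twist defect that is a finite-range flux interaction (vertical window `m`, transverse extent `s`,
# defect rows `b`), `2(d−1)N|β| + b < 1`, rate `−log c/(m s)`

HONEST FRAMING: venture file of the cell `pub-ymgap` (QuantumFields programme), track Y2 ROBUST-BALL, seat ds-4 g8.
WHAT THIS IS: a strong-coupling LATTICE theorem, uniform in the volume — for every `N ≥ 2`, every `d`, every torus `L`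
and every perturbation `W` of the `SU(N)` Wilson action whose twist defect is a FINITE-RANGE FLUX INTERACTION
(`IsFluxLocalW m s b W`: `W(ζ_k U) = c(U) + ∑_t g_t((curl k)|_{supp t}, U)` with finitely many plaquette supports, each
inside a vertical window — its `i`-links at cyclic `i`-distance `< m`, every `i` — and of transverse extent `≤ s`, bounds
`|g_t| ≤ B_t` with Dobrushin defect rows `∑_{t ∋ y} B_t(|iLinks i (supp t)| − 1) ≤ b`; NOTHING asked of the
twist-invariant part `c(U)` — no ball, no range, no window), the fundamental `R × T` Wilson loops obey
`|⟨W_{R×T}⟩_{β,W,L}| ≤ C^{2(R+T)} e^{−c RT}` with ONE pair `(C, c) = (2, −log max(2(d−1)N|β| + b, 1/2)/(m s))` whenever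
`2(d−1)N|β| + b < 1` (`areaLawCentreTubeW`).  The single-plaquette tube `AreaLawCentreTube N d β a` of `CentreTubeAreaLaw`
is the case `m = s = 1`, `b = 2(d−1)a` (`IsFluxLocal.isFluxLocalW`, `AreaLawCentreTubeW.areaLawCentreTube`); the new
members are multi-plaquette defects of nonzero `N`-ality around ANY linkwise centre-blind action — p1's `1×2`-rectangle
(Symanzik) action is typed as a member in `CentreTubeWindowMembers`; clover / box terms fit the same format.  HONEST LABEL (ROBUST-BALL-STATEMENT §6(c) verbatim + one
clause): a strong-coupling lattice INEQUALITY between expectations (centre dominance) + a windowed `ℤ_N`-layer area law —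
no confinement claim for `SU(N)` beyond that; `β`-window SMALLER than tier 1's; nonzero-`N`-ality loops only; nothing
continuum / spectral / Clay; no string-tension EXISTENCE claim for non-Wilson members; centre-projected `ℤ_N` flux
picture; the tube is open only for FINITE-RANGE, VERTICALLY WINDOWED flux defects (window `m`, extent `s`) — T15's
unwindowed multi-plaquette nonzero-`N`-ality loop terms (`not_areaLawOnBallC`: defect = `ψ` of the flux through a LARGE
loop) stay OUTSIDE, consistently with T15; the rate is a door artefact (the Seiler ceiling applies).

Mechanism: `CentreProjectionWindow` (centre dominance with a finite-range flux defect) + `ZNFluxWindowPeeling` (windowed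
Durhuus–Fröhlich peeling for `ℤ_N` lattice gauge theories with finite-range flux interactions).  References for the
blind case AS PRINTED: J. Fröhlich, Phys. Lett. B 83 (1979) 195, Eq. (7)–(9); G. Mack, V. B. Petkova, Ann. Phys. 123
(1979) 442, §2; B. Durhuus, J. Fröhlich, Comm. Math. Phys. 75 (1980) 103 (windowed peeling).
-/

noncomputable section

open Finset
open Literature.MathematicalPhysics.QuantumLattice (fundamentalRep)
open Literature.MathematicalPhysics.QuantumFieldTheory

namespace Summit.Ventures.YMGap.RobustBall

open ZN ZNFluxW

variable {d L N : ℕ}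

/-! ### The class: finite-range flux-local twist defects -/

/-- **`IsFluxLocalW m s b W`** — the twist defect of `W` is a FINITE-RANGE FLUX INTERACTION: a twist-invariant part `c(U)`
(arbitrary) plus finitely many terms `g_t(φ, U)` reading the flux configuration `φ = curl k` only on a plaquette support
`supp t` (`DependsOn`), with bounds `|g_t| ≤ B_t`, `0 ≤ B_t`, every support inside a VERTICAL WINDOW (its `i`-links at
cyclic `i`-distance `< m`, every direction `i`), of TRANSVERSE EXTENT `≤ s` (`j`-distance `≤ s`, every `i, j`), and
Dobrushin DEFECT ROWS `∑_{t : y ∈ iLinks i (supp t)} B_t (|iLinks i (supp t)| − 1) ≤ b` (every `i`, every `i`-link `y`),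
such that `W.total (ζ_k · U) = c(U) + ∑_t g_t(curl k, U)` for every linkwise twist `k`.  (Index type `Fin n`: any finite
family.)  `IsFluxLocal a W` is the case `m = s = 1`, `b = 2(d−1)a` (`IsFluxLocal.isFluxLocalW`). [folklore] -/
def IsFluxLocalW [NeZero L] [NeZero N] (m s : ℕ) (b : ℝ) (W : Perturbation d L N) : Prop :=
  ∃ (n : ℕ) (c : GaugeConfig d L (SUN N) → ℝ) (supp : Fin n → Finset (Plaquette d L))
    (gD : Fin n → (Plaquette d L → ZMod N) → GaugeConfig d L (SUN N) → ℝ) (B : Fin n → ℝ),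
    (∀ t U, DependsOn (fun φ => gD t φ U) (↑(supp t) : Set (Plaquette d L))) ∧ (∀ t, 0 ≤ B t) ∧
    (∀ t φ U, |gD t φ U| ≤ B t) ∧
    (∀ t (i : Fin d), ∀ y ∈ iLinks i (supp t), ∀ y' ∈ iLinks i (supp t), (y i - y' i).valMinAbs.natAbs < m) ∧
    (∀ t (i j : Fin d), ∀ y ∈ iLinks i (supp t), ∀ y' ∈ iLinks i (supp t), jDist j y' y ≤ s) ∧
    (∀ (i : Fin d) (y : Site d L), ∑ t ∈ Finset.univ.filter (fun t => y ∈ iLinks i (supp t)),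
      B t * (((iLinks i (supp t)).card : ℝ) - 1) ≤ b) ∧
    ∀ (k : Edge d L → ZMod N) (U : GaugeConfig d L (SUN N)), W.total (twistOf k * U) = c U + ∑ t, gD t (flux k) U

/-- Monotonicity in the window, the extent and the defect rows. [folklore] -/
theorem IsFluxLocalW.mono [NeZero L] [NeZero N] {m m' s s' : ℕ} {b b' : ℝ} (hm : m ≤ m') (hs : s ≤ s') (hb : b ≤ b')
    {W : Perturbation d L N} (hW : IsFluxLocalW m s b W) : IsFluxLocalW m' s' b' W := by
  obtain ⟨n, c, supp, gD, B, hdep, hB0, hB, hwin, hext, hrow, hW⟩ := hW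
  exact ⟨n, c, supp, gD, B, hdep, hB0, hB, fun t i y hy y' hy' => (hwin t i y hy y' hy').trans_le hm,
    fun t i j y hy y' hy' => (hext t i j y hy y' hy').trans hs, fun i y => (hrow i y).trans hb, hW⟩

/-- **Any finite index type**: a finite-range flux defect presented over an arbitrary `Fintype ι` gives `IsFluxLocalW`
(reindex along `Fintype.equivFin`). [folklore] -/
theorem isFluxLocalW_of_family [NeZero L] [NeZero N] {ι : Type*} [Fintype ι] {m s : ℕ} {b : ℝ} {W : Perturbation d L N}
    (c : GaugeConfig d L (SUN N) → ℝ) (supp : ι → Finset (Plaquette d L))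
    (gD : ι → (Plaquette d L → ZMod N) → GaugeConfig d L (SUN N) → ℝ) (B : ι → ℝ)
    (hdep : ∀ t U, DependsOn (fun φ => gD t φ U) (↑(supp t) : Set (Plaquette d L))) (hB0 : ∀ t, 0 ≤ B t)
    (hB : ∀ t φ U, |gD t φ U| ≤ B t)
    (hwin : ∀ t (i : Fin d), ∀ y ∈ iLinks i (supp t), ∀ y' ∈ iLinks i (supp t), (y i - y' i).valMinAbs.natAbs < m)
    (hext : ∀ t (i j : Fin d), ∀ y ∈ iLinks i (supp t), ∀ y' ∈ iLinks i (supp t), jDist j y' y ≤ s)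
    (hrow : ∀ (i : Fin d) (y : Site d L), ∑ t ∈ Finset.univ.filter (fun t => y ∈ iLinks i (supp t)),
      B t * (((iLinks i (supp t)).card : ℝ) - 1) ≤ b)
    (hW : ∀ (k : Edge d L → ZMod N) (U : GaugeConfig d L (SUN N)), W.total (twistOf k * U) = c U + ∑ t, gD t (flux k) U) :
    IsFluxLocalW m s b W := by
  classical
  set e := (Fintype.equivFin ι).symm with he
  refine ⟨Fintype.card ι, c, fun t => supp (e t), fun t => gD (e t), fun t => B (e t), fun t U => hdep (e t) U,
    fun t => hB0 (e t), fun t => hB (e t), fun t => hwin (e t), fun t => hext (e t), fun i y => ?_, fun k U => ?_⟩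
  · refine le_trans (le_of_eq ?_) (hrow i y)
    rw [Finset.sum_filter, Finset.sum_filter]
    exact Fintype.sum_equiv e _ _ fun t => rfl
  · rw [hW k U]
    congr 1
    exact (Fintype.sum_equiv e _ _ fun t => rfl).symm

/-- **A twist-blind part costs nothing**: `W_b + W` has the same finite-range defect data as `W`. [folklore] -/
theorem IsFluxLocalW.twistBlind_add [NeZero L] [NeZero N] {m s : ℕ} {b : ℝ} {Wb W : Perturbation d L N}
    (hb : IsTwistBlind Wb) (hW : IsFluxLocalW m s b W) : IsFluxLocalW m s b (Wb + W) := by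
  obtain ⟨n, c, supp, gD, B, hdep, hB0, hB, hwin, hext, hrow, hW⟩ := hW
  refine ⟨n, fun U => Wb.total U + c U, supp, gD, B, hdep, hB0, hB, hwin, hext, hrow, fun k U => ?_⟩
  rw [QuasiLocalGaugePerturbation.total_add, Pi.add_apply, hb k U, hW k U, add_assoc]

/-- **Sums**: finite-range defect families add (index `Fin n ⊕ Fin n'`): windows and extents combine by `max`, defect
rows add. [folklore] -/
theorem IsFluxLocalW.add [NeZero L] [NeZero N] {m m' s s' : ℕ} {b b' : ℝ} {W W' : Perturbation d L N}
    (hW : IsFluxLocalW m s b W) (hW' : IsFluxLocalW m' s' b' W') :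
    IsFluxLocalW (max m m') (max s s') (b + b') (W + W') := by
  classical
  obtain ⟨n, c, supp, gD, B, hdep, hB0, hB, hwin, hext, hrow, hW⟩ := hW
  obtain ⟨n', c', supp', gD', B', hdep', hB0', hB', hwin', hext', hrow', hW'⟩ := hW'
  refine isFluxLocalW_of_family (ι := Fin n ⊕ Fin n') (fun U => c U + c' U) (Sum.elim supp supp') (Sum.elim gD gD')
    (Sum.elim B B') ?_ ?_ ?_ ?_ ?_ (fun i y => ?_) (fun k U => ?_)
  · rintro (t | t) U
    · exact hdep t U
    · exact hdep' t U
  · rintro (t | t)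
    · exact hB0 t
    · exact hB0' t
  · rintro (t | t) φ U
    · exact hB t φ U
    · exact hB' t φ U
  · rintro (t | t) i y hy y' hy'
    · exact (hwin t i y hy y' hy').trans_le (le_max_left _ _)
    · exact (hwin' t i y hy y' hy').trans_le (le_max_right _ _)
  · rintro (t | t) i j y hy y' hy'
    · exact (hext t i j y hy y' hy').trans (le_max_left _ _)
    · exact (hext' t i j y hy y' hy').trans (le_max_right _ _)
  · rw [Finset.sum_filter, Fintype.sum_sum_type]
    simp only [Sum.elim_inl, Sum.elim_inr]
    rw [← Finset.sum_filter, ← Finset.sum_filter]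
    exact add_le_add (hrow i y) (hrow' i y)
  · rw [QuasiLocalGaugePerturbation.total_add, Pi.add_apply, hW k U, hW' k U, Fintype.sum_sum_type]
    simp only [Sum.elim_inl, Sum.elim_inr]
    ring

/-- **The windowed centre-tube bound for the class** (`N ≥ 2`, `0 < m`, `0 < s`, `c = 2(d−1)N|β| + b ≤ 1`):
`|⟨W_{R×T}⟩_{β,W,L}| ≤ (4 c^{⌈T/s⌉})^{#{r<R : m∣r}}`. [folklore] -/
theorem abs_wilsonLoop_le_of_isFluxLocalW [NeZero L] [NeZero N] (hN : 2 ≤ N) {β b c : ℝ} {m s : ℕ} (hm : 0 < m)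
    (hs : 0 < s) (hc : 2 * ((d - 1 : ℕ) : ℝ) * |β| * N + b ≤ c) (hc1 : c ≤ 1) (W : Perturbation d L N)
    (hW : IsFluxLocalW m s b W) (x : Site d L) {i j : Fin d} (hij : i ≠ j) {R T : ℕ} (hR : 2 * R ≤ L) (hT : 2 * T ≤ L) :
    |W.expectation (fundamentalRep (Fin N)) β (wilsonLoop (fundamentalRep (Fin N)) x i j R T)| ≤
      (4 * c ^ ((T + s - 1) / s)) ^ (selIdx m R).card := by
  obtain ⟨n, c₀, supp, gD, B, hdep, hB0, hB, hwin, hext, hrow, hW⟩ := hW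
  exact abs_wilsonLoop_le_of_fluxDefect hN W hW hdep hB0 hB hm hwin hs hext hrow hc hc1 x hij hR hT

/-! ### Single-plaquette defects are the case `m = s = 1`, `b = 2(d−1)a` -/

/-- **`IsFluxLocal a W → IsFluxLocalW 1 1 (2(d−1)a) W`**: index the single-plaquette defects by the plaquettes; each
support is a singleton (`|iLinks| ≤ 2`, window `1`, extent `1`), and at most `2(d−1)` plaquettes read a given `i`-link. [folklore] -/
theorem IsFluxLocal.isFluxLocalW [NeZero L] [NeZero N] {a : ℝ} (ha : 0 ≤ a) {W : Perturbation d L N}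
    (hW : IsFluxLocal a W) : IsFluxLocalW 1 1 (2 * ((d - 1 : ℕ) : ℝ) * a) W := by
  classical
  obtain ⟨c, g, hg, hW⟩ := hW
  set e := (Fintype.equivFin (Plaquette d L)).symm with he
  refine ⟨Fintype.card (Plaquette d L), c, fun t => {e t}, fun t φ U => g (e t) (φ (e t)) U, fun _ => a,
    fun t U φ φ' h => ?_, fun _ => ha, fun t φ U => hg _ _ _, fun t i y hy y' hy' => ?_, fun t i j y hy y' hy' => ?_,
    fun i y => ?_, fun k U => ?_⟩
  · show g (e t) (φ (e t)) U = g (e t) (φ' (e t)) U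
    rw [h (e t) (by simp)]
  · rw [iLinks_singleton] at hy hy'
    rw [iDist_eq_zero_of_mem_iSites i (e t) hy hy']; exact Nat.one_pos
  · rw [iLinks_singleton] at hy hy'
    exact jDist_le_one_of_mem_iSites i j (e t) hy hy'
  · -- rows: `a · #{t : y ∈ iSites i (e t)} ≤ 2(d−1) a`
    simp only [iLinks_singleton]
    calc ∑ t ∈ Finset.univ.filter (fun t => y ∈ iSites i (e t)), a * (((iSites i (e t)).card : ℝ) - 1)
        ≤ ∑ t ∈ Finset.univ.filter (fun t => y ∈ iSites i (e t)), a := by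
          refine Finset.sum_le_sum fun t _ => ?_
          have h2 : ((iSites i (e t)).card : ℝ) ≤ 2 := by exact_mod_cast card_iSites_le i (e t)
          nlinarith
      _ = a * ((Finset.univ.filter (fun t => y ∈ iSites i (e t))).card : ℝ) := by
          rw [Finset.sum_const, nsmul_eq_mul, mul_comm]
      _ ≤ a * (2 * (d - 1) : ℕ) := by
          refine mul_le_mul_of_nonneg_left ?_ ha
          have hc : (Finset.univ.filter (fun t => y ∈ iSites i (e t))).card =
              ((Finset.univ : Finset (Plaquette d L)).filter fun p => y ∈ iSites i p).card := by
            rw [← Finset.card_map e.toEmbedding]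
            congr 1
            ext p
            simp only [Finset.mem_map_equiv, Finset.mem_filter, Finset.mem_univ, true_and]
            rw [show e (e.symm p) = p from e.apply_symm_apply p]
          rw [hc]; exact_mod_cast card_filter_mem_iSites_le i y
      _ = 2 * ((d - 1 : ℕ) : ℝ) * a := by push_cast; ring
  · rw [hW k U]
    congr 1
    exact (Fintype.sum_equiv e _ _ fun t => rfl).symm

/-! ### The currency -/

/-- **`AreaLawCentreTubeW N d β m s b`** — the body of `AreaLawCentreTube` / `AreaLawOnBall` with the hypothesis
`IsFluxLocalW m s b W` (finite-range flux-local twist defect: vertical window `m`, transverse extent `s`, defect rows `b`;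
NOTHING on the twist-invariant part): constants `C, c > 0` with `|⟨W_{R×T}⟩_{β,W,L}| ≤ C^{2(R+T)} e^{−c RT}` for every
torus, every such `W`, every non-wrapping rectangle. [folklore] -/
def AreaLawCentreTubeW (N d : ℕ) [NeZero N] (β : ℝ) (m s : ℕ) (b : ℝ) : Prop :=
  ∃ C c : ℝ, 0 < c ∧ ∀ (L : ℕ) [NeZero L] (W : Perturbation d L N), IsFluxLocalW m s b W →
    ∀ (x : Site d L) (i j : Fin d) (R T : ℕ), i ≠ j → 1 ≤ R → 1 ≤ T → 2 * R ≤ L → 2 * T ≤ L →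
      |W.expectation (fundamentalRep (Fin N)) β (wilsonLoop (fundamentalRep (Fin N)) x i j R T)| ≤
        C ^ (2 * (R + T)) * Real.exp (-c * (R * T))

/-- The windowed currency is antitone in `(m, s, b)`. [folklore] -/
theorem AreaLawCentreTubeW.anti [NeZero N] {β : ℝ} {m m' s s' : ℕ} {b b' : ℝ} (hm : m ≤ m') (hs : s ≤ s')
    (hb : b ≤ b') (hA : AreaLawCentreTubeW N d β m' s' b') : AreaLawCentreTubeW N d β m s b := by
  obtain ⟨C, c, hc, hA⟩ := hA
  exact ⟨C, c, hc, fun L _ W hW => hA L W (hW.mono hm hs hb)⟩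

/-- **The windowed tube contains the single-plaquette tube**: `AreaLawCentreTubeW N d β m s (2(d−1)a)` with `1 ≤ m, s`
implies `AreaLawCentreTube N d β a` (`0 ≤ a`), same constants; hence also `AreaLawCentreBlind N d β`. [folklore] -/
theorem AreaLawCentreTubeW.areaLawCentreTube [NeZero N] {β a b : ℝ} {m s : ℕ} (hm : 1 ≤ m) (hs : 1 ≤ s) (ha : 0 ≤ a)
    (hb : 2 * ((d - 1 : ℕ) : ℝ) * a ≤ b) (hA : AreaLawCentreTubeW N d β m s b) : AreaLawCentreTube N d β a := by
  obtain ⟨C, c, hc, hA⟩ := hA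
  exact ⟨C, c, hc, fun L _ W hW => hA L W ((hW.isFluxLocalW ha).mono hm hs hb)⟩

/-- **Degenerate reading** (`m = s = 1`, `b = 0`): the windowed tube of radius `0` is the centre-blind class —
`AreaLawCentreTubeW N d β 1 1 0 → AreaLawCentreBlind N d β` (every twist-blind `W` is `IsFluxLocal 0`, hence
`IsFluxLocalW 1 1 0`). [folklore] -/
theorem AreaLawCentreTubeW.areaLawCentreBlind_zero [NeZero N] {β : ℝ} (hA : AreaLawCentreTubeW N d β 1 1 0) :
    AreaLawCentreBlind N d β :=
  (hA.areaLawCentreTube le_rfl le_rfl le_rfl (by simp)).areaLawCentreBlind le_rfl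

/-! ### The theorem -/

/-- **THE WINDOWED CENTRE-TUBE AREA LAW**: for every `N ≥ 2`, every `d`, `0 < m`, `0 < s`, every `b` and every tree
coupling `β` with `2(d−1)N|β| + b < 1`, `AreaLawCentreTubeW N d β m s b` holds with `C = 2` and rate
`c = −log max(2(d−1)N|β| + b, 1/2)/(m s)`.  HONEST LABEL: strong-coupling lattice statement, finite tori uniformly in
`L`, fundamental loops; `β`-window smaller than tier 1's; the tube is open only in finite-range, vertically windowed
flux directions; nothing continuum / spectral / Clay. [cite: Frohlich1979ZN, Eq. (7)–(9)] -/
theorem areaLawCentreTubeW [NeZero N] (hN : 2 ≤ N) {β b : ℝ} {m s : ℕ} (hm : 0 < m) (hs : 0 < s)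
    (hβ : 2 * ((d - 1 : ℕ) : ℝ) * |β| * N + b < 1) : AreaLawCentreTubeW N d β m s b := by
  set c := max (2 * ((d - 1 : ℕ) : ℝ) * |β| * N + b) (1 / 2) with hcdef
  have hc0 : 0 < c := lt_max_of_lt_right (by norm_num)
  have hc1 : c < 1 := max_lt hβ (by norm_num)
  have hcle : 2 * ((d - 1 : ℕ) : ℝ) * |β| * N + b ≤ c := le_max_left _ _
  refine ⟨2, -Real.log c / (m * s), div_pos (neg_pos.2 (Real.log_neg hc0 hc1)) (by positivity),
    fun L _ W hW x i j R T hij _ _ hRL hTL => ?_⟩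
  exact (abs_wilsonLoop_le_of_isFluxLocalW hN hm hs hcle hc1.le W hW x hij hRL hTL).trans
    (windowBound_le_areaLawShape hc0 hc1.le hm hs R T)

/-! ### Rows -/

/-- **SU(2), `d = 4`**: the windowed centre-tube area law whenever `6 β_W + b < 1` (`β_W = 2β`), any window `m ≥ 1` and
extent `s ≥ 1` (rate `−log max(6β_W + b, 1/2)/(m s)`). [folklore] -/
theorem su2_areaLawCentreTubeW_dim4 {β b : ℝ} {m s : ℕ} (hm : 0 < m) (hs : 0 < s)
    (h : 6 * (2 * |β|) + b < 1) : AreaLawCentreTubeW 2 4 β m s b :=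
  areaLawCentreTubeW (le_refl 2) hm hs (by push_cast; linarith)

/-- **SU(2), `d = 3`**: the windowed centre-tube area law whenever `4 β_W + b < 1`. [folklore] -/
theorem su2_areaLawCentreTubeW_dim3 {β b : ℝ} {m s : ℕ} (hm : 0 < m) (hs : 0 < s)
    (h : 4 * (2 * |β|) + b < 1) : AreaLawCentreTubeW 2 3 β m s b :=
  areaLawCentreTubeW (le_refl 2) hm hs (by push_cast; linarith)

/-- **SU(3), `d = 4`**: the windowed centre-tube area law whenever `6 β_W + b < 1` (`β_W = 3β`). [folklore] -/
theorem su3_areaLawCentreTubeW_dim4 {β b : ℝ} {m s : ℕ} (hm : 0 < m) (hs : 0 < s)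
    (h : 6 * (3 * |β|) + b < 1) : AreaLawCentreTubeW 3 4 β m s b :=
  areaLawCentreTubeW (by norm_num) hm hs (by push_cast; linarith)

/-- **Every `SU(N)`, `d = 4`, 't Hooft scaling** (`β = N·βt`): the windowed centre-tube area law whenever
`6 N² |βt| + b < 1`. [folklore] -/
theorem suN_areaLawCentreTubeW_dim4 [NeZero N] (hN : 2 ≤ N) {βt b : ℝ} {m s : ℕ} (hm : 0 < m) (hs : 0 < s)
    (h : 6 * ((N : ℝ) ^ 2 * |βt|) + b < 1) : AreaLawCentreTubeW N 4 ((N : ℝ) * βt) m s b :=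
  areaLawCentreTubeW hN hm hs (by
    have hNn : (0 : ℝ) ≤ N := Nat.cast_nonneg N
    rw [abs_mul, abs_of_nonneg hNn]; push_cast; nlinarith)

end Summit.Ventures.YMGap.RobustBall

end
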